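import Summits.CriticalPhenomena.PercolationContinuityZ3.Theorems.PercNearOneGluingNoHeavyLowerTailSahiCTCLadderThreeRowTwoDenseFacts
import HarnessLib

/-!
# `NoHeavyLowerTail` (crux stmt-CriticalPhenomena-4575), P3 lane: the row `#dbl = 2` of `(L_3)` in the dense-triple regime — PART 3/3: the theorem `coeff_ladder_three_rowTwo_nonneg_of_dense`

Support file (seat `prim-l12-p3`, gen 26, split into three files ≤ 400 lines and landed gen 42; `--supports stmt-CriticalPhenomena-4575`).  Memo g26 §4.12.  For a profile `m = 2·1_D + 1_T`
with `#D = 2` the cubes of `[m](e_3·H)` are the 3-live RESTRICTIONS `κ(∅, D ∪ T∖y)` (`y ∈ T`), the 2-live LINKS `κ({d_i}, d_j ∪ T∖Q)`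
(`Q ⊆ T` a pair) and the 1-live double links `κ(D, T∖E)` (`E ⊆ T` a triple); the charge is `cH(3,τ+1)·a + cH(2,τ−1)·(q₁+q₂) +
cH(1,τ−3)·ε` with `a = #{y : D + y ∈ 𝒳∩𝒵}`, `q_j = #{Q : d_j + Q ∈ 𝒳∩𝒵}`, `ε = #{E ⊆ T : E ∈ 𝒳∩𝒵}`.  Peeling the restriction cubes at
`d₁` and `d₂` (`kap_rec`) and bounding every resulting cube by t-DENSITY proves the row whenever `6ε ≥ a(τ−1)(τ−2)` (triples at least as
dense as the set `𝒜`): **`coeff_ladder_three_rowTwo_nonneg_of_dense`** (`τ ≥ 7`; exact at `H_3`).  Nothing is asserted about the crux.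
-/

namespace Summit.CriticalPhenomena.PercolationContinuityZ3.Theorems.SahiCTCForms

open Finset MvPolynomial SahiCTCGenFun SahiCTCWeightedLYM

variable {α : Type*} [DecidableEq α] [Fintype α]

section RowTwo
variable {𝒳 𝒵 : Finset (Finset α)}

/-- **Row `#dbl = 2` of `(L_3)` in the dense regime** (memo §4.12): if the common triples inside `T` and the common pairs `d_j + Q` are at
least as dense as the set `𝒜 = {y : D + y ∈ 𝒳 ∩ 𝒵}` — `6ε ≥ a(τ−1)(τ−2)` and `q₁ + q₂ ≥ a(τ−1)` — and `τ ≥ 7`, then `[m] L_3 ≥ 0`.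
[this work] -/
theorem coeff_ladder_three_rowTwo_nonneg_of_dense (h𝒳 : IsUpperSet (𝒳 : Set (Finset α))) (h𝒵 : IsUpperSet (𝒵 : Set (Finset α)))
    (hX3 : ∀ S ∈ 𝒳, 3 ≤ #S) (hZ3 : ∀ S ∈ 𝒵, 3 ≤ #S) {m : α →₀ ℕ} (hm : ∀ i, m i ≤ 2) (hD : #(dbl m) = 2) (hτ : 7 ≤ #(lev m 1))
    (hdense₁ : (#(((lev m 1).powersetCard 1).filter fun Y => dbl m ∪ Y ∈ 𝒳 ∧ dbl m ∪ Y ∈ 𝒵)) * (#(lev m 1) - 1) * (#(lev m 1) - 2) ≤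
      6 * #(((lev m 1).powersetCard 3).filter fun E => E ∈ 𝒳 ∧ E ∈ 𝒵))
    (hdense₂ : (#(((lev m 1).powersetCard 1).filter fun Y => dbl m ∪ Y ∈ 𝒳 ∧ dbl m ∪ Y ∈ 𝒵)) * (#(lev m 1) - 1) ≤
      ∑ d ∈ dbl m, #(((lev m 1).powersetCard 2).filter fun Q => insert d Q ∈ 𝒳 ∧ insert d Q ∈ 𝒵)) :
    0 ≤ (ee 3 * (PiP * gf (𝒳 ∩ 𝒵) - gf 𝒳 * gf 𝒵) -
      gf (bySize (· ≤ 3 - 1) : Finset (Finset α)) * gf (bySize (3 ≤ ·) : Finset (Finset α)) *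
        gf ((𝒳 ∩ 𝒵).filter fun S => #S = 3)).coeff m := by
  set W := (𝒳 ∩ 𝒵).filter fun S => #S = 3 with hWdef
  have hW3 : ∀ w ∈ W, #w = 3 := fun w hw => (mem_filter.1 hw).2
  have hWsub : ∀ w ∈ W, w ∈ 𝒳 ∧ w ∈ 𝒵 := fun w hw => mem_inter.1 (mem_filter.1 hw).1
  have hDT : Disjoint (dbl m) (lev m 1) := disjoint_dbl_lev_one m
  obtain ⟨d₁, d₂, h12, hDeq⟩ := card_eq_two.1 hD
  have hd₁ : d₁ ∈ dbl m := by rw [hDeq]; simp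
  have hd₂ : d₂ ∈ dbl m := by rw [hDeq]; simp
  have hd₁T : d₁ ∉ lev m 1 := fun h => disjoint_left.1 hDT hd₁ h
  have hd₂T : d₂ ∉ lev m 1 := fun h => disjoint_left.1 hDT hd₂ h
  rw [coeff_sub, sub_nonneg]
  refine (coeff_chargeT_rowTwo_le hm hD (by omega) W hW3).trans (le_trans ?_ (cubes_le_coeff_ee_mul_harris_rowTwo h𝒳 h𝒵 hm hD))
  have hn₁ : d₁ ∉ ({d₂} : Finset α) := by simp [h12]
  have hsumD : ∀ f : α → ℤ, ∑ d ∈ dbl m, f d = f d₁ + f d₂ := fun f => by rw [hDeq, sum_insert hn₁, sum_singleton]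
  have hsumDn : ∀ f : α → ℕ, ∑ d ∈ dbl m, f d = f d₁ + f d₂ := fun f => by rw [hDeq, sum_insert hn₁, sum_singleton]
  rw [hsumDn] at hdense₂
  -- charge counts against a, q, ε
  have haW : #(((lev m 1).powersetCard 1).filter fun Y => dbl m ∪ Y ∈ W) ≤
      #(((lev m 1).powersetCard 1).filter fun Y => dbl m ∪ Y ∈ 𝒳 ∧ dbl m ∪ Y ∈ 𝒵) :=
    card_le_card fun Y hY => mem_filter.2 ⟨(mem_filter.1 hY).1, hWsub _ (mem_filter.1 hY).2⟩
  have hqW : ∀ d, #(((lev m 1).powersetCard 2).filter fun Q => insert d Q ∈ W) ≤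
      #(((lev m 1).powersetCard 2).filter fun Q => insert d Q ∈ 𝒳 ∧ insert d Q ∈ 𝒵) := fun d =>
    card_le_card fun Q hQ => mem_filter.2 ⟨(mem_filter.1 hQ).1, hWsub _ (mem_filter.1 hQ).2⟩
  have hεW : #(((lev m 1).powersetCard 3).filter fun E => E ∈ W) ≤ #(((lev m 1).powersetCard 3).filter fun E => E ∈ 𝒳 ∧ E ∈ 𝒵) :=
    card_le_card fun E hE => mem_filter.2 ⟨(mem_filter.1 hE).1, hWsub _ (mem_filter.1 hE).2⟩
  -- split the restriction cubes at d₁, d₂ and the link cubes at the other doubled point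
  have hR : ∀ Y ∈ (lev m 1).powersetCard 1,
      kap 𝒳 𝒵 ∅ (lev m 1 \ Y) + kap 𝒳 𝒵 {d₂} (lev m 1 \ Y) + (kap 𝒳 𝒵 {d₁} (lev m 1 \ Y) + kap 𝒳 𝒵 (dbl m) (lev m 1 \ Y)) ≤
        kap 𝒳 𝒵 ∅ (dbl m ∪ (lev m 1 \ Y)) := fun Y hY => by
    have hV1 : d₁ ∉ lev m 1 \ Y := fun h => hd₁T (mem_sdiff.1 h).1
    have hV2 : d₂ ∉ lev m 1 \ Y := fun h => hd₂T (mem_sdiff.1 h).1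
    have e : dbl m ∪ (lev m 1 \ Y) = insert d₁ (insert d₂ (lev m 1 \ Y)) := by rw [hDeq, insert_union, ← insert_eq]
    have s1 := kap_add_kap_le_kap_insert h𝒳 h𝒵 (D := (∅ : Finset α)) (s' := insert d₂ (lev m 1 \ Y)) (notMem_empty d₁)
      (by rw [mem_insert, not_or]; exact ⟨h12, hV1⟩)
    have s2 := kap_add_kap_le_kap_insert h𝒳 h𝒵 (D := (∅ : Finset α)) (s' := lev m 1 \ Y) (notMem_empty d₂) hV2
    have s3 := kap_add_kap_le_kap_insert h𝒳 h𝒵 (D := ({d₁} : Finset α)) (s' := lev m 1 \ Y) (v := d₂)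
      (by rw [mem_singleton]; exact h12.symm) hV2
    rw [insert_empty_eq] at s1 s2
    rw [show insert d₂ ({d₁} : Finset α) = dbl m from by rw [hDeq, pair_comm]] at s3
    rw [e]; linarith
  have hM : ∀ (d d' : α), dbl m = {d, d'} → d ≠ d' → ∀ Q ∈ (lev m 1).powersetCard 2,
      kap 𝒳 𝒵 {d'} (lev m 1 \ Q) + kap 𝒳 𝒵 (dbl m) (lev m 1 \ Q) ≤ kapL1 𝒳 𝒵 m d Q := fun d d' hDe hdd' Q hQ => by
    unfold kapL1
    have hdm : d ∈ dbl m := by rw [hDe]; simp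
    have hdT : d ∉ lev m 1 := fun h => disjoint_left.1 hDT hdm h
    have he : (dbl m).erase d = {d'} := by
      rw [hDe]; ext i; simp only [mem_erase, mem_insert, mem_singleton]
      constructor
      · rintro ⟨hne, h | h⟩; exact absurd h hne; exact h
      · rintro rfl; exact ⟨hdd'.symm, Or.inr rfl⟩
    have s := kap_add_kap_le_kap_insert h𝒳 h𝒵 (D := ({d'} : Finset α)) (s' := lev m 1 \ Q) (v := d)
      (by rw [mem_singleton]; exact hdd') (fun h => hdT (mem_sdiff.1 h).1)
    rw [show insert d ({d'} : Finset α) = dbl m from by rw [hDe]] at s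
    rw [he]; linarith
  have sRt := sum_le_sum hR
  simp only [sum_add_distrib] at sRt
  have sMa := sum_le_sum (hM d₁ d₂ hDeq h12)
  have sMb := sum_le_sum (hM d₂ d₁ (by rw [hDeq, pair_comm]) h12.symm)
  rw [sum_add_distrib] at sMa sMb
  -- n = τ − 1 and the numeric constants of the charge
  obtain ⟨n, hn⟩ : ∃ n : ℕ, #(lev m 1) = n + 1 := ⟨#(lev m 1) - 1, by omega⟩
  have hn6 : 6 ≤ n := by omega
  have h1n : 1 ≤ n := by omega
  have h2n : 2 ≤ n := by omega
  have ecH3 : 2 * (cH 3 n : ℤ) = (n : ℤ) ^ 2 + n + 2 := two_mul_cH_three (by omega)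
  have eΓ : 2 * (cH 3 (#(lev m 1) + 1) : ℤ) = ((n : ℤ) + 2) ^ 2 + (n + 2) + 2 := by
    rw [hn]; have := two_mul_cH_three (n := n + 2) (by omega); push_cast at this ⊢; linarith
  have ecH2 : (cH 2 (#(lev m 1) - 1) : ℤ) = n + 1 := by
    have hcH2 : cH 2 n = n + 1 := by unfold cH; rw [show min 2 (n + 1 - 2) = 2 from by omega]; simp [sum_range_succ]; omega
    rw [hn, Nat.add_sub_cancel, hcH2]; push_cast; ring
  have ecH1 : (cH 1 (#(lev m 1) - 3) : ℤ) = 1 := by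
    have hcH1 : cH 1 (n - 2) = 1 := by unfold cH; rw [show min 1 (n - 2 + 1 - 1) = 1 from by omega]; simp
    rw [hn, show n + 1 - 3 = n - 2 from by omega, hcH1]; simp
  -- the goal in family form
  rw [hsumD fun d => ∑ Q ∈ (lev m 1).powersetCard 2, kapL1 𝒳 𝒵 m d Q,
    hsumDn fun d => #(((lev m 1).powersetCard 2).filter fun Q => insert d Q ∈ W)]
  push_cast
  rw [ecH2, ecH1, one_mul]
  -- the density facts and the dense-regime hypotheses in integer form
  obtain ⟨f1, f2, f3⟩ := rowTwo_density_facts_R h𝒳 h𝒵 hX3 hZ3 hD hDeq hn hn6 (𝒳 := 𝒳) (𝒵 := 𝒵)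
  obtain ⟨f4, f5, f6⟩ := rowTwo_density_facts_ML h𝒳 h𝒵 hX3 hZ3 hD hDeq hn hn6 (𝒳 := 𝒳) (𝒵 := 𝒵)
  rw [hn, Nat.add_sub_cancel, show n + 1 - 2 = n - 1 from by omega] at hdense₁
  rw [hn, Nat.add_sub_cancel] at hdense₂
  have hd1 : ((#(((lev m 1).powersetCard 1).filter fun Y => dbl m ∪ Y ∈ 𝒳 ∧ dbl m ∪ Y ∈ 𝒵)) : ℤ) * n * (n - 1) ≤
      6 * #(((lev m 1).powersetCard 3).filter fun E => E ∈ 𝒳 ∧ E ∈ 𝒵) := by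
    have := hdense₁; zify [h1n] at this; linarith
  have hd2 : ((#(((lev m 1).powersetCard 1).filter fun Y => dbl m ∪ Y ∈ 𝒳 ∧ dbl m ∪ Y ∈ 𝒵)) : ℤ) * n ≤
      (#(((lev m 1).powersetCard 2).filter fun Q => insert d₁ Q ∈ 𝒳 ∧ insert d₁ Q ∈ 𝒵) : ℤ) +
        #(((lev m 1).powersetCard 2).filter fun Q => insert d₂ Q ∈ 𝒳 ∧ insert d₂ Q ∈ 𝒵) := by exact_mod_cast hdense₂
  have haW' : (#(((lev m 1).powersetCard 1).filter fun Y => dbl m ∪ Y ∈ W) : ℤ) ≤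
      #(((lev m 1).powersetCard 1).filter fun Y => dbl m ∪ Y ∈ 𝒳 ∧ dbl m ∪ Y ∈ 𝒵) := by exact_mod_cast haW
  have hq1W : (#(((lev m 1).powersetCard 2).filter fun Q => insert d₁ Q ∈ W) : ℤ) ≤
      #(((lev m 1).powersetCard 2).filter fun Q => insert d₁ Q ∈ 𝒳 ∧ insert d₁ Q ∈ 𝒵) := by exact_mod_cast hqW d₁
  have hq2W : (#(((lev m 1).powersetCard 2).filter fun Q => insert d₂ Q ∈ W) : ℤ) ≤
      #(((lev m 1).powersetCard 2).filter fun Q => insert d₂ Q ∈ 𝒳 ∧ insert d₂ Q ∈ 𝒵) := by exact_mod_cast hqW d₂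
  have hεW' : (#(((lev m 1).powersetCard 3).filter fun E => E ∈ W) : ℤ) ≤ #(((lev m 1).powersetCard 3).filter fun E => E ∈ 𝒳 ∧ E ∈ 𝒵) := by
    exact_mod_cast hεW
  have hε0 : (0 : ℤ) ≤ #(((lev m 1).powersetCard 3).filter fun E => E ∈ W) := Nat.cast_nonneg _
  have hfin := rowTwo_dense_arith (n := (n : ℤ)) (by exact_mod_cast hn6) f1 f2 f3 f4 f5 f6 ecH3 eΓ haW' (add_le_add hq1W hq2W) hεW' hε0
    hd1 hd2
  push_cast at hfin
  linarith [hfin, sRt, sMa, sMb]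

end RowTwo

end Summit.CriticalPhenomena.PercolationContinuityZ3.Theorems.SahiCTCForms
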